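import Summits.PneNP.PneNP.Theorems.GapMCSPWindowCellZeroFlipLaw

/-!
# Gap-MCSP window cell `q = 0` (trade-off law) — IV. Rooted unfolding of a gate list

Part of the tree landing of HOME/decomp-pnenp-lens-1/TradeOffLaw.lean (sha256 880b490f…, lens-1 g13 of the decomp-pnenp root-decomposition cell; critic NODE-VERDICT 2026-08-30T13:09:32Z CLEARED, landing endorsed (6)(a)):
a SIZE–ACCEPTANCE TRADE-OFF for every `B₂`-circuit on `N` inputs that accepts `0^N` and every point
indicator `e_p` — `N ≤ 9·L·(L + G + 3 − N)`, `L = ⌊log₂ acc⌋`, `G` = number of gates — and its payout: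
the Oliveira–Pich–Santhanam gap problem `Gap-MCSP[2^{βn}/(cn), 2^{βn}]` (census R3) is not separated by
`B₂`-circuit families of eventually `≤ N` gates (`0 < β < 1/3`, every `c ≥ 1`), i.e. the `q = 0` cell of
the window dial of route `route-PneNP-RootDecompMagnificationPayout` (item stmt-PneNP-33309 `WindowCellZero`,
BC5 rung for the attacked item stmt-PneNP-32096). Modules, in dependency order: `…Formulas` (rooted
`B₂`-formulas and additive valuations) → `…Counting` (uniform counting, silent/flipping variables, numeric
helpers) → `…FlipLaw` (the exact acceptance law for read-once formulas) → `…Unfolding` (rooted unfolding of a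
gate list, consistency, references) → `…Potential` (variables/nodes of unfoldings, the root potential: no
duplication across root formulas) → `…Relevance` (relevant roots, link, locality) → `…Product` (boxes, the two
exponent bounds, pigeonhole, the final arithmetic) → `…Count` (`t + 2·nocc ≤ 2G + 3`) → `GapMCSPWindowCellZero`
(the law proved, the payout in tree vocabulary). Proof-internal machinery: nothing here bears on P vs NP
beyond the S-free lower bound it proves; all statements are [folklore]-tagged kernel lemmas of the lens.

THIS FILE (lens §4, first part): gate-list bookkeeping (`cntI`, `cnt`, `reads`, `refL`, well-formedness `WFL`),
the ROOTED UNFOLDING `UR R gs m` of gate `m` of a fan-in-`≤ 2` program cut at a root predicate `R` (root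
wires become reference leaves, other inputs literals, other gates are expanded recursively), CONSISTENCY
(`eval_UR`: in an environment agreeing with the true wire values every unfolding computes its gate) and the
reference structure (`refs_UR`: references are roots of smaller index). Over the tree's `GateList` API
(`Literature/Computability/Complexity/CircuitComposition.lean`).
-/

noncomputable section

set_option linter.dupNamespace false -- `Summit.PneNP.PneNP.…`: summit = sub-problem name (D-0017 single-conjunct layout)

namespace Summit.PneNP.PneNP.Theorems.GapMCSPWindowCellZero

open Literature.Computability.Complexity

/-! ## §4 ROOTED UNFOLDING of a `B₂`-circuit: cut at a set `R` of ROOT WIRES, expand the rest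

Given a gate list `gs` (fan-in `≤ 2`, acyclic) and a predicate `R` on wires, gate `m` unfolds to
the `BF` formula `UR R gs m` in which every argument wire `w` with `R w` becomes the reference
leaf `ref w`, every other input wire becomes a literal and every other gate wire is expanded
recursively; the gate node keeps its index. With `R :=` "input read `≥ 2` times, or gate of
fan-out `≥ 2`, or the output gate" every expanded wire has fan-out `≤ 1`, so (ROOT POTENTIAL,
g12 §8 generalised to an arbitrary additive valuation) nothing is duplicated ACROSS the root
formulas: every variable and every gate index occurs at most once in all of them together. -/

section Unfolding

open Finset
open Literature.Computability.Complexity.GateList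

variable {N : ℕ}

namespace BF

/-! ### Gate-list bookkeeping -/

/-- Number of argument slots of `g` wired to input `i`. [folklore] -/
def cntI (g : Gate (Fin N)) (i : Fin N) : ℕ := (univ.filter fun a : Fin g.arity => g.args a = .inl i).card

/-- Number of argument slots of `g` wired to gate `m`. [folklore] -/
def cnt (g : Gate (Fin N)) (m : ℕ) : ℕ := (univ.filter fun a : Fin g.arity => g.args a = .inr m).card

/-- How often input `i` is read by the program. [folklore] -/
def reads (gs : List (Gate (Fin N))) (i : Fin N) : ℕ := (gs.map fun g => cntI g i).sum

/-- Fan-out of gate `m` inside the program. [folklore] -/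
def refL (gs : List (Gate (Fin N))) (m : ℕ) : ℕ := (gs.map fun g => cnt g m).sum

/-- `reads` of an extended program: the new gate adds its input slots. -/
theorem reads_append_singleton (gs : List (Gate (Fin N))) (g : Gate (Fin N)) (i : Fin N) :
    reads (gs ++ [g]) i = reads gs i + cntI g i := by simp [reads]

/-- `refL` of an extended program: the new gate adds its gate slots. -/
theorem refL_append_singleton (gs : List (Gate (Fin N))) (g : Gate (Fin N)) (m : ℕ) :
    refL (gs ++ [g]) m = refL gs m + cnt g m := by simp [refL]

/-- A slot wired to input `i` witnesses `cntI g i ≥ 1`. -/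
theorem one_le_cntI {g : Gate (Fin N)} {a : Fin g.arity} {i : Fin N} (h : g.args a = .inl i) :
    1 ≤ cntI g i := card_pos.2 ⟨a, by simp [h]⟩

/-- A slot wired to gate `m` witnesses `cnt g m ≥ 1`. -/
theorem one_le_cnt {g : Gate (Fin N)} {a : Fin g.arity} {m : ℕ} (h : g.args a = .inr m) :
    1 ≤ cnt g m := card_pos.2 ⟨a, by simp [h]⟩

/-- Well-formedness of a bare gate list (gate `j` reads only gates `m < j`). [folklore] -/
def WFL (gs : List (Gate (Fin N))) : Prop :=
  ∀ (j : ℕ) (g : Gate (Fin N)), gs[j]? = some g → ∀ (a : Fin g.arity) (m : ℕ), g.args a = .inr m → m < j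

/-- Well-formedness is inherited by the initial segment. [folklore] -/
theorem WFL.init {gs : List (Gate (Fin N))} {g : Gate (Fin N)} (h : WFL (gs ++ [g])) : WFL gs := by
  intro j g' hg' a m ha
  obtain ⟨hj, -⟩ := List.getElem?_eq_some_iff.1 hg'
  refine h j g' ?_ a m ha
  rw [List.getElem?_append_left hj]
  exact hg'

/-- In a well-formed program the last gate reads only earlier gates. [folklore] -/
theorem WFL.last {gs : List (Gate (Fin N))} {g : Gate (Fin N)} (h : WFL (gs ++ [g]))
    (a : Fin g.arity) (m : ℕ) (ha : g.args a = .inr m) : m < gs.length :=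
  h gs.length g (by simp) a m ha

/-- No gate of a well-formed program reads a gate index beyond the program. [folklore] -/
theorem refL_eq_zero_of_le {gs : List (Gate (Fin N))} (h : WFL gs) {m : ℕ} (hm : gs.length ≤ m) :
    refL gs m = 0 := by
  induction gs using List.reverseRecOn generalizing m with
  | nil => simp [refL]
  | append_singleton gs g ih =>
    rw [refL_append_singleton, ih h.init (by simp at hm; omega)]
    simp only [cnt, zero_add, card_eq_zero, filter_eq_empty_iff, mem_univ, true_implies]
    intro a ha
    have := h.last a m ha
    simp at hm; omega

/-- The newly appended gate of a well-formed program is not yet read. [folklore] -/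
theorem refL_new_eq_zero {gs : List (Gate (Fin N))} {g : Gate (Fin N)} (h : WFL (gs ++ [g])) :
    refL (gs ++ [g]) gs.length = 0 := by
  rw [refL_append_singleton, refL_eq_zero_of_le h.init le_rfl, zero_add]
  simp only [cnt, card_eq_zero, filter_eq_empty_iff, mem_univ, true_implies]
  intro a ha
  have := h.last a _ ha
  omega

/-! ### The rooted unfolding -/

variable (R : Fin N ⊕ ℕ → Bool)

/-- The sub-formula attached to an argument wire: a reference leaf if the wire is a root,
else the literal / the earlier unfolding. [folklore] -/
def childR (us : List (BF N)) (w : Fin N ⊕ ℕ) : BF N :=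
  if R w then ref w else
    match w with
    | .inl i => lit i true
    | .inr m => us.getD m (cst false)

/-- Rooted unfolding of one gate of fan-in `≤ 2`, as a gate node with index `j`. [folklore] -/
def unfOfR (j : ℕ) (us : List (BF N)) : Gate (Fin N) → BF N
  | ⟨0, op, _⟩ => gate j (fun _ _ => op Fin.elim0) (cst false) (cst false)
  | ⟨1, op, args⟩ => gate j (fun a _ => op fun _ => a) (childR R us (args 0)) (cst false)
  | ⟨2, op, args⟩ => gate j (fun a b => op ![a, b]) (childR R us (args 0)) (childR R us (args 1))
  | _ => cst false

/-- Rooted unfoldings of all gates, in program order. [folklore] -/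
def unfsR (gs : List (Gate (Fin N))) : List (BF N) :=
  gs.foldl (fun us g => us ++ [unfOfR R us.length us g]) []

/-- Unfolding an extended program appends the unfolding of the new gate. -/
theorem unfsR_append_singleton (gs : List (Gate (Fin N))) (g : Gate (Fin N)) :
    unfsR R (gs ++ [g]) = unfsR R gs ++ [unfOfR R (unfsR R gs).length (unfsR R gs) g] := by
  simp [unfsR, List.foldl_append]

/-- There is one rooted unfolding per gate. -/
@[simp] theorem length_unfsR (gs : List (Gate (Fin N))) : (unfsR R gs).length = gs.length := by
  induction gs using List.reverseRecOn with
  | nil => rfl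
  | append_singleton gs g ih => simp [unfsR_append_singleton, ih]

/-- The rooted unfolding of gate `m` (junk `cst false` out of range). [folklore] -/
def UR (gs : List (Gate (Fin N))) (m : ℕ) : BF N := (unfsR R gs).getD m (cst false)

/-- Appending a gate does not change the unfoldings of earlier gates. -/
theorem UR_append_of_lt {gs : List (Gate (Fin N))} (g : Gate (Fin N)) {m : ℕ} (hm : m < gs.length) :
    UR R (gs ++ [g]) m = UR R gs m := by
  simp only [UR, unfsR_append_singleton]
  rw [List.getD_append _ _ _ _ (by simpa using hm)]

/-- The unfolding of the appended gate. -/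
theorem UR_append_self (gs : List (Gate (Fin N))) (g : Gate (Fin N)) :
    UR R (gs ++ [g]) gs.length = unfOfR R gs.length (unfsR R gs) g := by
  simp only [UR, unfsR_append_singleton]
  rw [List.getD_append_right _ _ _ _ (by simp)]
  simp

/-- Out-of-range unfoldings are the junk constant `false`. -/
theorem UR_of_le {gs : List (Gate (Fin N))} {m : ℕ} (hm : gs.length ≤ m) : UR R gs m = cst false := by
  simp only [UR]
  rw [List.getD_eq_default _ _ (by simpa using hm)]

/-- The child formula at a gate wire: a reference leaf at a root, else the earlier unfolding. -/
theorem childR_inr (gs : List (Gate (Fin N))) (m : ℕ) :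
    childR R (unfsR R gs) (.inr m) = if R (.inr m) then ref (.inr m) else UR R gs m := by
  simp [childR, UR]

/-- The child formula at an input wire: a reference leaf at a root, else the literal. -/
theorem childR_inl (us : List (BF N)) (i : Fin N) :
    childR R us (.inl i) = if R (.inl i) then ref (.inl i) else lit i true := by
  simp [childR]

/-! ### Consistency: the unfoldings compute the gate values -/

/-- Consistency of the child formulas with the wire values (induction step). [folklore] -/
theorem eval_childR (gs : List (Gate (Fin N))) (x : Fin N → Bool) (ρ : Fin N ⊕ ℕ → Bool)
    (hρi : ∀ i, ρ (.inl i) = x i)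
    (hρm : ∀ m < gs.length, ρ (.inr m) = (vals gs x).getD m false)
    (h : ∀ m, (UR R gs m).eval ρ x = (vals gs x).getD m false) (w : Fin N ⊕ ℕ)
    (hw : ∀ m, w = .inr m → m < gs.length) :
    (childR R (unfsR R gs) w).eval ρ x = wireOf x (vals gs x) w := by
  cases w with
  | inl i =>
    rw [childR_inl]
    split_ifs with hR
    · simp [eval, hρi]
    · simp [eval]
  | inr m =>
    rw [childR_inr]
    split_ifs with hR
    · simpa [eval] using hρm m (hw m rfl)
    · simpa using h m

/-- Consistency of the unfolding of one gate of fan-in `≤ 2` (induction step). [folklore] -/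
theorem eval_unfOfR (gs : List (Gate (Fin N))) (x : Fin N → Bool) (ρ : Fin N ⊕ ℕ → Bool)
    (hρi : ∀ i, ρ (.inl i) = x i)
    (hρm : ∀ m < gs.length, ρ (.inr m) = (vals gs x).getD m false)
    (h : ∀ m, (UR R gs m).eval ρ x = (vals gs x).getD m false) (g : Gate (Fin N))
    (hg : g.arity ≤ 2) (hwf : ∀ (a : Fin g.arity) (m : ℕ), g.args a = .inr m → m < gs.length) (j : ℕ) :
    (unfOfR R j (unfsR R gs) g).eval ρ x = g.op fun a => wireOf x (vals gs x) (g.args a) := by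
  rcases g with ⟨_ | _ | _ | k, op, args⟩
  · simp only [unfOfR, eval]
    congr 1
    funext a
    exact Fin.elim0 a
  · simp only [unfOfR, eval]
    congr 1
    funext a
    rw [Subsingleton.elim a 0]
    exact eval_childR R gs x ρ hρi hρm h (args 0) (fun m hm => hwf 0 m hm)
  · simp only [unfOfR, eval]
    congr 1
    funext a
    fin_cases a
    · simpa using eval_childR R gs x ρ hρi hρm h (args 0) (fun m hm => hwf 0 m hm)
    · simpa using eval_childR R gs x ρ hρi hρm h (args 1) (fun m hm => hwf 1 m hm)
  · simp at hg

/-- **CONSISTENCY**: in an environment that agrees with the actual wire values of `x`, every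
rooted unfolding evaluates at `x` to the value of its gate. [folklore] -/
theorem eval_UR (x : Fin N → Bool) :
    ∀ gs : List (Gate (Fin N)), WFL gs → (∀ g ∈ gs, g.arity ≤ 2) →
      ∀ ρ : Fin N ⊕ ℕ → Bool, (∀ i, ρ (.inl i) = x i) →
        (∀ m < gs.length, ρ (.inr m) = (vals gs x).getD m false) →
        ∀ m, (UR R gs m).eval ρ x = (vals gs x).getD m false := by
  intro gs
  induction gs using List.reverseRecOn with
  | nil => intro _ _ ρ _ _ m; simp [UR, unfsR, eval]
  | append_singleton gs g ih =>
    intro hwf har ρ hρi hρm m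
    have har' : ∀ g' ∈ gs, g'.arity ≤ 2 := fun g' hg' => har g' (by simp [hg'])
    have hvals : ∀ m < gs.length, (vals (gs ++ [g]) x).getD m false = (vals gs x).getD m false :=
      fun m hm => by rw [vals_append_singleton, List.getD_append _ _ _ _ (by simpa using hm)]
    have hρm' : ∀ m < gs.length, ρ (.inr m) = (vals gs x).getD m false := fun m hm => by
      rw [← hvals m hm]; exact hρm m (by simp; omega)
    have ih' := ih hwf.init har' ρ hρi hρm'
    rcases Nat.lt_trichotomy m gs.length with hm | hm | hm
    · rw [UR_append_of_lt R g hm, hvals m hm]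
      exact ih' m
    · subst hm
      rw [UR_append_self, vals_append_singleton, List.getD_append_right _ _ _ _ (by simp)]
      simp only [length_vals, Nat.sub_self, List.getD_cons_zero]
      exact eval_unfOfR R gs x ρ hρi hρm' ih' g (har g (by simp)) (fun a m ha => hwf.last a m ha) _
    · rw [UR_of_le R (by simp; omega), List.getD_eq_default _ _ (by simp; omega)]
      simp [eval]

/-! ### Structure of the unfoldings: references, variables, gate nodes -/

/-- References of a rooted unfolding are root wires of strictly smaller index. [folklore] -/
theorem refs_UR : ∀ gs : List (Gate (Fin N)), WFL gs →
    ∀ m w, w ∈ (UR R gs m).refs → R w = true ∧ ∀ m', w = .inr m' → m' < m ∧ m' < gs.length := by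
  intro gs
  induction gs using List.reverseRecOn with
  | nil => intro _ m w hw; simp [UR, unfsR, refs] at hw
  | append_singleton gs g ih =>
    intro hwf m w hw
    have ih' := ih hwf.init
    -- references of a child
    have hchild : ∀ w₀ : Fin N ⊕ ℕ, (∀ m', w₀ = .inr m' → m' < gs.length) →
        ∀ w, w ∈ (childR R (unfsR R gs) w₀).refs →
          R w = true ∧ ∀ m', w = .inr m' → m' < gs.length ∧ m' < gs.length + 1 := by
      intro w₀ hw₀ w hw
      cases w₀ with
      | inl i =>
        rw [childR_inl] at hw
        split_ifs at hw with hR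
        · simp only [refs, mem_singleton] at hw
          subst hw
          exact ⟨hR, fun m' h => by cases h⟩
        · simp [refs] at hw
      | inr m₁ =>
        rw [childR_inr] at hw
        have hm₁ := hw₀ m₁ rfl
        split_ifs at hw with hR
        · simp only [refs, mem_singleton] at hw
          subst hw
          refine ⟨hR, fun m' h => ?_⟩
          cases h
          exact ⟨hm₁, by omega⟩
        · obtain ⟨h1, h2⟩ := ih' m₁ w hw
          exact ⟨h1, fun m' hm' => by have := h2 m' hm'; omega⟩
    rcases Nat.lt_trichotomy m gs.length with hm | hm | hm
    · rw [UR_append_of_lt R g hm] at hw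
      obtain ⟨h1, h2⟩ := ih' m w hw
      exact ⟨h1, fun m' hm' => by have := h2 m' hm'; simp; omega⟩
    · subst hm
      rw [UR_append_self] at hw
      have hwf' : ∀ (a : Fin g.arity) (m' : ℕ), g.args a = .inr m' → m' < gs.length :=
        fun a m' ha => hwf.last a m' ha
      have main : ∀ w, (∃ a : Fin g.arity, w ∈ (childR R (unfsR R gs) (g.args a)).refs) →
          R w = true ∧ ∀ m', w = .inr m' → m' < gs.length ∧ m' < (gs ++ [g]).length := by
        rintro w' ⟨a, ha⟩
        have := hchild (g.args a) (fun m' hm' => hwf' a m' hm') w' ha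
        simpa using this
      apply main
      rcases g with ⟨_ | _ | _ | k, op, args⟩
      · simp [unfOfR, refs] at hw
      · simp only [unfOfR, refs, mem_union] at hw
        rcases hw with hw | hw
        · exact ⟨0, hw⟩
        · simp at hw
      · simp only [unfOfR, refs, mem_union] at hw
        rcases hw with hw | hw
        · exact ⟨0, hw⟩
        · exact ⟨1, hw⟩
      · simp [unfOfR, refs] at hw
    · rw [UR_of_le R (by simp; omega)] at hw
      simp [refs] at hw

end BF

end Unfolding

end Summit.PneNP.PneNP.Theorems.GapMCSPWindowCellZero
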